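import Summits.ABC.IUTFork.Thm311LogKummer
import Mathlib.Algebra.Group.Subgroup.Lattice
import Mathlib.Order.Closure
import HarnessLib

/-!
# [IUTchIII] Theorem 3.11 in the author's terms, G: the Θ-pilot's possible images — the nouns Cor. 3.12 takes from Thm. 3.11

Record-only file (D-0012) of the abc-iut cell (seat abc-iut-c312-1); TAKES NO SIDE. Sequel to A–C
(`Thm311Sig`, `Thm311Multirad`, `Thm311LogKummer`). [IUTchIII] Corollary 3.12 (kurims p. 173 l. 41 –
p. 174; the statement and its proof are seat abc-iut-c312-2's) opens "Suppose that we are in the situation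
of Theorem 3.11. Write `−|log(Θ)| ∈ ℝ ∪ {+∞}` for the procession-normalized mono-analytic log-volume [i.e.,
where the average is taken over `j ∈ F_l^⋇` — cf. Remark 3.1.1, (ii), (iii), (iv); Proposition 3.9, (i),
(ii); Theorem 3.11, (i), (a)] of the holomorphic hull [cf. Remark 3.9.5, (i)] of the union of the possible
images of a Θ-pilot object [cf. Definition 3.8, (i)], relative to the relevant Kummer isomorphisms [cf.
Theorem 3.11, (ii)], in the multiradial representation of Theorem 3.11, (i), which we regard as subject to
the indeterminacies (Ind1), (Ind2), (Ind3) described in Theorem 3.11, (i), (ii). Write `−|log(q)| ∈ ℝ` for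
the procession-normalized mono-analytic log-volume of the image of a `q`-pilot object [cf. Definition 3.8,
(i)], relative to the relevant Kummer isomorphisms [cf. Theorem 3.11, (ii)], in the multiradial
representation of Theorem 3.11, (i), which we do not regard as subject to the indeterminacies (Ind1),
(Ind2), (Ind3)".

This file DEFINES these nouns over the typed situation of Theorem 3.11 (`LatticeSituation`, file C) and
a SIGNATURE `PilotNouns` for the three things Theorem 3.11 itself does not construct: the region of the
tensor packet `I^ℚ(^{S^±_{j+1}};^{n,∘}D⊢_{v_ℚ})` determined, through the Kummer isomorphisms of (ii), by the
Θ-pilot object of `^{n,m}HT` and by its `q`-pilot object (Def. 3.8 (i); Prop. 3.9 (iii) "the elements of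
"`M(−)`" determined by objects"; Rmk. 3.9.5), the (Ind3)-ENLARGEMENT of the former ("upper
semi-compatible": only an upper bound is available — cf. Dupuy–Hilado p. 4: "`(O_𝕃(−P_Θ))^{Ind3}` … is not
just the application of the function `Ind3` on a set"), and the holomorphic hull of Rmk. 3.9.5 (i) as a
closure operator on regions. Then:

* `IndGroup S` := the subgroup of packet-automorphism families generated by the (Ind1)- and (Ind2)-families
  (`Thm311Multirad`): the indeterminacies (Ind1), (Ind2) "acting on" the multiradial representation;
* `possibleImages n m j v_ℚ` := the images, under `IndGroup`, of the (Ind3)-enlarged Θ-pilot region —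
  "the possible images of a Θ-pilot object … subject to (Ind1), (Ind2), (Ind3)", component at `(j, v_ℚ)`;
* `Uhol` := hull of their union; `negLogTheta n m` := `(1/l⋇) Σ_{j ∈ F_l^⋇} Σ_{v_ℚ} μ^log(Uhol)`;
  `negLogQ n m` := the same for the `q`-pilot region WITHOUT indeterminacies; `Cor312At n m` := the
  displayed `−|log(Θ)| ≥ −|log(q)|` (HYPOTHESIS — the disputed inequality; never asserted);
* bookkeeping: `thetaRegion3_mem_possibleImages` (the identity indeterminacy), `subset_Uhol`.

Per `(j, v_ℚ)` this is the shape of the cell's `ForkRegions.Cor312Setting` (possible images `U_λ`,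
`Q`, hull, log-volume), to which a one-line bridge applies once that skeleton file lands; the aggregate
over `(j, v_ℚ)` ("procession-normalized", "global") is the author's. Sources read on the page: [IUTchIII]
pp. 112 (Def. 3.8 (i)), 115–117 (Prop. 3.9), 173–174 (Cor. 3.12). [claim: Mochizuki2012, status: disputed]
[cite: DupuyHilado2025, §1 p. 4]
Deliberately NOT here: Cor. 3.12's proof and its Step (xi) (abc-iut-c312-2); the computation of
`−|log(Θ)|` ([IUTchIV] §1); any judgement.
-/

noncomputable section

namespace Summit.ABC

namespace IUTFork

namespace Thm311

variable {T : ThetaIndex}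

/-- `F_l^⋇` is finite (so the procession average `(1/l⋇) Σ_{j ∈ F_l^⋇}` is a finite sum). [folklore] -/
instance ThetaIndex.finite_labelStar (T : ThetaIndex) : Finite T.LabelStar := by
  unfold ThetaIndex.LabelStar; infer_instance

/-! ## 1. The group generated by (Ind1), (Ind2) -/

namespace LogShells

variable (L : LogShells T)

/-- Packet-automorphism families form a group (pointwise composition). [folklore] -/
instance : Group L.PacketAut := inferInstanceAs (Group (∀ (j : T.Label) (vQ : T.VQ), _))

/-- The group of indeterminacies GENERATED by the (Ind1)-families and the (Ind2)-families — (Ind1),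
(Ind2) "acting on" the data of the multiradial representation ([IUTchIII] Thm. 3.11 (i); Cor. 3.12
"subject to the indeterminacies (Ind1), (Ind2)"). [claim: Mochizuki2012, status: disputed] -/
def IndGroup : Subgroup L.PacketAut := Subgroup.closure (L.Ind1Family ∪ L.Ind2Family)

/-- The identity family is an indeterminacy. [folklore] -/
theorem one_mem_indGroup : (1 : L.PacketAut) ∈ L.IndGroup := L.IndGroup.one_mem

/-- Every (Ind1)-family is in the generated group. [folklore] -/
theorem ind1Family_subset_indGroup : L.Ind1Family ⊆ L.IndGroup := fun _ h =>
  Subgroup.subset_closure (Set.mem_union_left _ h)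

/-- Every (Ind2)-family is in the generated group. [folklore] -/
theorem ind2Family_subset_indGroup : L.Ind2Family ⊆ L.IndGroup := fun _ h =>
  Subgroup.subset_closure (Set.mem_union_right _ h)

end LogShells

/-! ## 2. The pilot regions (signature) and Cor. 3.12's nouns (definitions) -/

/-- SIGNATURE for what Cor. 3.12 names but Theorem 3.11 does not construct, over the typed situation of
Theorem 3.11: for the Θ-pilot object of `^{n,m}HT^{Θ±ell NF}` (Def. 3.8 (i): the object of `†C^⊩_LGP`
"determined by any collection, indexed by `v ∈ V^bad`, of generators up to torsion of the monoids
`Ψ^⊥_{F_lgp}(†HT^{Θ±ell NF})_v`") and its `q`-pilot object ("determined by the "`q_v`", for `v ∈ V^bad`"),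
the REGIONS of the tensor packets `I^ℚ(^{S^±_{j+1}};^{n,∘}D⊢_{v_ℚ})`, `j ∈ F_l^⋇`, they determine "relative
to the relevant Kummer isomorphisms [cf. Theorem 3.11, (ii)], in the multiradial representation of Theorem
3.11, (i)" (Prop. 3.9 (iii): objects determine elements of `M(−)`; Rmk. 3.9.5); the (Ind3)-ENLARGEMENT of
the Θ-pilot region (Thm. 3.11 (ii) (Ind3): the Kummer isomorphisms of (ii)(a) are only "upper
semi-compatible"); and the HOLOMORPHIC HULL of Rmk. 3.9.5 (i) on regions of each packet, relative to
the arithmetic holomorphic structure of the vertical line `n`. TODO-merge: abc-iut-L6-t4 (Def. 3.8 (i),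
Prop. 3.9 (iii), Rmk. 3.9.5), abc-iut-c312-3 (Dupuy–Hilado `O_𝕃(−P_Θ)`, `(−)^{Ind3}`, `hull`).
[claim: Mochizuki2012, status: disputed] -/
structure PilotNouns (S : LatticeSituation T) where
  /-- the holomorphic hull on regions of `I^ℚ(^{S^±_{j+1}};^{n,∘}D⊢_{v_ℚ})` for the line `n` -/
  hull : ∀ (n : ℤ) (j : T.Label) (vQ : T.VQ), ClosureOperator (Set (S.L.Packet j vQ))
  /-- the region at `(j, v_ℚ)` determined by the Θ-pilot object of `(n, m)` through the Kummer isomorphisms -/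
  thetaRegion : ∀ (n m : ℤ) (j : T.LabelStar) (vQ : T.VQ), Set (S.L.Packet j.1 vQ)
  /-- its (Ind3)-enlargement -/
  thetaRegion3 : ∀ (n m : ℤ) (j : T.LabelStar) (vQ : T.VQ), Set (S.L.Packet j.1 vQ)
  /-- (Ind3) only enlarges -/
  thetaRegion_subset : ∀ n m j vQ, thetaRegion n m j vQ ⊆ thetaRegion3 n m j vQ
  /-- the region at `(j, v_ℚ)` determined by the `q`-pilot object of `(n, m)` -/
  qRegion : ∀ (n m : ℤ) (j : T.LabelStar) (vQ : T.VQ), Set (S.L.Packet j.1 vQ)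

namespace PilotNouns

variable {S : LatticeSituation T} (P : PilotNouns S)

/-- **The possible images of a Θ-pilot object** at the component `(j, v_ℚ)` ([IUTchIII] Cor. 3.12: "the
possible images of a Θ-pilot object …, relative to the relevant Kummer isomorphisms …, in the multiradial
representation of Theorem 3.11, (i), which we regard as subject to the indeterminacies (Ind1), (Ind2),
(Ind3)"): the images of the (Ind3)-enlarged Θ-pilot region under the group generated by (Ind1), (Ind2)
(Dupuy–Hilado's `U_Θ = Ind2·(Ind1·(O_𝕃(−P_Θ))^{Ind3})`, component-wise). [claim: Mochizuki2012, status: disputed] -/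
def possibleImages (n m : ℤ) (j : T.LabelStar) (vQ : T.VQ) : Set (Set (S.L.Packet j.1 vQ)) :=
  {R | ∃ Φ ∈ S.L.IndGroup, R = Φ j.1 vQ '' P.thetaRegion3 n m j vQ}

/-- The (Ind3)-enlarged region itself is a possible image (identity indeterminacy). [folklore] -/
theorem thetaRegion3_mem_possibleImages (n m : ℤ) (j : T.LabelStar) (vQ : T.VQ) :
    P.thetaRegion3 n m j vQ ∈ P.possibleImages n m j vQ :=
  ⟨1, S.L.one_mem_indGroup, by simp [LinearEquiv.coe_one, Set.image_id']⟩

/-- **The holomorphic hull of the union of the possible images**, component `(j, v_ℚ)` (Cor. 3.12;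
Rmk. 3.9.5 (i)). [claim: Mochizuki2012, status: disputed] -/
def Uhol (n m : ℤ) (j : T.LabelStar) (vQ : T.VQ) : Set (S.L.Packet j.1 vQ) :=
  P.hull n j.1 vQ (⋃₀ P.possibleImages n m j vQ)

/-- Every possible image lies in the hull of the union. [folklore] -/
theorem subset_Uhol {n m : ℤ} {j : T.LabelStar} {vQ : T.VQ} {R : Set (S.L.Packet j.1 vQ)}
    (hR : R ∈ P.possibleImages n m j vQ) : R ⊆ P.Uhol n m j vQ :=
  (Set.subset_sUnion_of_mem hR).trans ((P.hull n j.1 vQ).le_closure _)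

/-- The bare Θ-pilot region lies in the hull of the union of the possible images. [folklore] -/
theorem thetaRegion_subset_Uhol (n m : ℤ) (j : T.LabelStar) (vQ : T.VQ) :
    P.thetaRegion n m j vQ ⊆ P.Uhol n m j vQ :=
  (P.thetaRegion_subset n m j vQ).trans (P.subset_Uhol (P.thetaRegion3_mem_possibleImages n m j vQ))

/-- **`−|log(Θ)|`** for the Θ-pilot object of `(n, m)` ([IUTchIII] Cor. 3.12): "the procession-normalized
mono-analytic log-volume [i.e., where the average is taken over `j ∈ F_l^⋇` …] of the holomorphic hull of
the union of the possible images" — the average over `j ∈ F_l^⋇` of the global (sum over `v_ℚ`, Prop. 3.9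
(iii)) mono-analytic log-volumes of (i) (a). Typed `ℝ`-valued with `∑ᶠ` (zero outside finite support);
the printed "`∈ ℝ ∪ {+∞}`" / admissibility is the separate `Prop` `NegLogThetaReal`.
[claim: Mochizuki2012, status: disputed] -/
def negLogTheta (n m : ℤ) : ℝ :=
  (1 / (T.lstar : ℝ)) * ∑ᶠ (j : T.LabelStar) (vQ : T.VQ), (S.D n).logvol j.1 vQ (P.Uhol n m j vQ)

/-- "Then it holds that `−|log(Θ)| ∈ ℝ`" (Cor. 3.12): every hull is an admissible region (finite
log-volume) and only finitely many components contribute. HYPOTHESIS (part of Cor. 3.12's statement).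
[claim: Mochizuki2012, status: disputed] -/
@[claim "Mochizuki2012" "disputed"] def NegLogThetaReal (n m : ℤ) : Prop :=
  (∀ (j : T.LabelStar) (vQ : T.VQ), (S.D n).Adm j.1 vQ (P.Uhol n m j vQ)) ∧
    {p : T.LabelStar × T.VQ | (S.D n).logvol p.1.1 p.2 (P.Uhol n m p.1 p.2) ≠ 0}.Finite

/-- **`−|log(q)|`** for the `q`-pilot object of `(n, m)` (Cor. 3.12): "the procession-normalized
mono-analytic log-volume of the image of a `q`-pilot object …, which we do not regard as subject to the
indeterminacies (Ind1), (Ind2), (Ind3)". Typed `ℝ`-valued with `∑ᶠ`; the printed "`−|log(q)| ∈ ℝ`" (every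
`q`-pilot region admissible, finitely many nonzero components — otherwise `∑ᶠ` would silently return `0`)
is the separate `Prop` `NegLogQReal`, conjoined into `Cor312At`. [claim: Mochizuki2012, status: disputed] -/
def negLogQ (n m : ℤ) : ℝ :=
  (1 / (T.lstar : ℝ)) * ∑ᶠ (j : T.LabelStar) (vQ : T.VQ), (S.D n).logvol j.1 vQ (P.qRegion n m j vQ)

/-- "Write `−|log(q)| ∈ ℝ` for the procession-normalized mono-analytic log-volume of the image of a
`q`-pilot object" (Cor. 3.12, p. 174): every `q`-pilot region is admissible and only finitely many
components `(j, v_ℚ)` contribute — the guard that makes `negLogQ` an honest finite sum (referee finding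
R7-C1-F1). HYPOTHESIS (part of Cor. 3.12's statement). [claim: Mochizuki2012, status: disputed] -/
@[claim "Mochizuki2012" "disputed"] def NegLogQReal (n m : ℤ) : Prop :=
  (∀ (j : T.LabelStar) (vQ : T.VQ), (S.D n).Adm j.1 vQ (P.qRegion n m j vQ)) ∧
    {p : T.LabelStar × T.VQ | (S.D n).logvol p.1.1 p.2 (P.qRegion n m p.1 p.2) ≠ 0}.Finite

/-- "In particular, `|log(q)| > 0` is easily computed in terms of the various `q`-parameters of the
elliptic curve `E_F` … at `v ∈ V^bad (≠ ∅)`" (Cor. 3.12, p. 174): `−|log(q)| < 0`. Named `Prop` (its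
computation is [IUTchIV] Prop. 1.x / abc-iut-c312-3's `PilotDivisors`), not conjoined into `Cor312At`.
[claim: Mochizuki2012, status: disputed] -/
@[claim "Mochizuki2012" "disputed"] def AbsLogQPos (n m : ℤ) : Prop := P.negLogQ n m < 0

/-- **Corollary 3.12's inequality** for the pilot objects of `(n, m)`, in the author's nouns over the typed
situation of Theorem 3.11: "`−|log(Θ)| ∈ ℝ`, and `−|log(Θ)| ≥ −|log(q)|`" — with both log-volumes honest
finite sums (`NegLogThetaReal`, `NegLogQReal`). HYPOTHESIS — the disputed conclusion; typed here only so
that abc-iut-c312-2's chain and the skeleton's `Cor312Setting` have a common referent; never asserted.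
[claim: Mochizuki2012, status: disputed] -/
@[claim "Mochizuki2012" "disputed"] def Cor312At (n m : ℤ) : Prop :=
  P.NegLogThetaReal n m ∧ P.NegLogQReal n m ∧ P.negLogQ n m ≤ P.negLogTheta n m

/-! ## 3. When (Ind1), (Ind2) preserve log-volumes -/

/-- `LogvolIndInvariant S n j v_ℚ` := every indeterminacy of the group generated by (Ind1), (Ind2)
maps admissible regions of `I^ℚ(^{S^±_{j+1}};^{n,∘}D⊢_{v_ℚ})` to admissible regions OF THE SAME mono-analytic
log-volume. This is what [IUTchIV] Thm. 1.10, Step (v) uses of (Ind1), (Ind2) ("(Ind1) and (Ind2) are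
taken into account by the arbitrary nature of the automorphism "φ""; permutations of tensor factors and
isometries preserve the normalized log-volume) — a property an INSTANTIATION proves (Dupuy–Hilado §4.7–4.10;
the cell's `ForkHaar`/`ForkPadic` models); NOT assumed by Theorem 3.11 as typed, named here.
[claim: Mochizuki2012, status: disputed] -/
def _root_.Summit.ABC.IUTFork.Thm311.LatticeSituation.LogvolIndInvariant (S : LatticeSituation T)
    (n : ℤ) (j : T.LabelStar) (vQ : T.VQ) : Prop :=
  ∀ Φ ∈ S.L.IndGroup, ∀ A : Set (S.L.Packet j.1 vQ), (S.D n).Adm j.1 vQ A →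
    (S.D n).Adm j.1 vQ (Φ j.1 vQ '' A) ∧ (S.D n).logvol j.1 vQ (Φ j.1 vQ '' A) = (S.D n).logvol j.1 vQ A

/-- Under `LogvolIndInvariant`, EVERY possible image of the Θ-pilot object has the log-volume of the
(Ind3)-enlarged region: at the level of volumes, (Ind1) and (Ind2) contribute only through the HULL of
the union (cf. the cell's `ForkInflation.IndData.representedVol_iff_of_preserving`). [folklore] -/
theorem logvol_eq_of_mem_possibleImages {n m : ℤ} {j : T.LabelStar} {vQ : T.VQ}
    (h : S.LogvolIndInvariant n j vQ) (hadm : (S.D n).Adm j.1 vQ (P.thetaRegion3 n m j vQ))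
    {R : Set (S.L.Packet j.1 vQ)} (hR : R ∈ P.possibleImages n m j vQ) :
    (S.D n).Adm j.1 vQ R ∧ (S.D n).logvol j.1 vQ R = (S.D n).logvol j.1 vQ (P.thetaRegion3 n m j vQ) := by
  obtain ⟨Φ, hΦ, rfl⟩ := hR
  exact h Φ hΦ _ hadm

end PilotNouns

end Thm311

end IUTFork

end Summit.ABC

end
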